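import Literature.NumberTheory.ConnesConsani2021.ArchDensityRegularity
import Literature.NumberTheory.ConnesConsani2021.SeriesRemainderRokhlinFree
import HarnessLib

/-!
# Connes–Consani 2021, §5 / App. F WITHOUT the endpoint input (100): `ε ∘ exp` is `C²` on
# `[0, ∞)`, Prop. 5.3, the qualitative Lemma 5.4 and Rem. 5.6 from the core prolate datum (PROVED)

RH-FREE corpus literature (label, line 1): real analysis of the prolate series (sonine0) of
Thm. 4.7; nothing in this file mentions `ζ`, the critical strip or RH, and nothing here bears on the
truth of RH.  bears_on (cell rh-crit, corpus C1): apex input (B) «density of `E`» — route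
«ConnesConsaniSemilocal» items K0 `DensityRegular` and the analytic half of K2 `DensitySlope`.

Source: A. Connes, C. Consani, *Weil positivity and trace formula, the archimedean place*, Selecta
Math. (N.S.) 27 (2021) 77 = arXiv:2006.13771 [bib `ConnesConsani2021`]: Prop. 5.3 (arXiv Prop. 30,
p. 32), Lemma 5.4 (arXiv Lemma 31, pp. 32–33), Rem. 5.6 (arXiv Rem. 33, p. 34) and App. F «Issues
of convergence» (arXiv PDF pp. 54–55, chunk p0035).

## Why this file exists (cell rulings R55/R59, routes-1 2026-08-26T06:09:05Z)

`ArchDensityRegularity.lean` proves the same theorems from seat t6's full App. F datum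
`IsAppEProlateDatum`, one of whose fields is CC's (100) = [Rokhlin–Xiao 2007, Thm 12]
`|ξ_n(1)| ≤ √(2n+½)` — an inequality with NO proof in print (Bonami–Karoui 2014, p. 230: "frequently
cited (but not proved)").  The printed use of (100) is only to make `Σ_n λ(n)²(1−λ(n)²)⁻¹ξ_n(1)²`
converge.  Here the endpoint value is controlled WITHOUT any prolate input beyond the equation
itself: at the regular-singular endpoint `x = 1` the prolate equation reads
`2ψ′(1) = (χ − 4π²)ψ(1)`, and (74)′ `λψ′ = η̃′` with `|η̃′| ≤ 99π/35` gives
`|λ(n)|·|χ_n − 4π²|·|ψ_n(1)| ≤ 198π/35` (`IsAppFDatum.abs_lam_mul_apply_one_le`); with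
[Wang 2010] (2.6) `χ_n > 2n(2n+1)` (PROVED in the tree) the weighted endpoint values
`|2λ/(1−λ²)|·|ψ_n(1)|` are `O(1/n²)`, hence summable — which is all the termwise `C²` majorants
need.  Everything is stated over seat t6's §4-only datum `IsAppFDatum`
(`SeriesRemainderRokhlinFree.lean`: `IsAppEProlateDatum` minus (100) and minus the [Wang] fields,
the latter being theorems), which `exists_isAppFDatum_prolateFun` builds for THE prolate vectors
from the §4 named facts `CC2021_sec4_cosalphan` (PROVED: `CC2021_sec4_cosalphan_holds`),
`CC2021_sec4_lambda_basic`, `CC2021_sec4_rapidDecay`.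

## What is here (all PROVED; no definition, no named fact)

* the App. F toolkit over `IsAppFDatum` (`abs_coeff_le`, `prolateLambda_eq`, `integral_abs_le`,
  `integral_abs_scaleDerivIn_le`, kernel and boundary bounds with `|ψ(1)|` kept explicit,
  `abs_derivs_le(_poly)`: `|g^{(k)}| ≤ A₁(L)p(n) + A₂(L)|ψ(1)|`);
* `IsAppFDatum.abs_lam_mul_apply_one_le`, `abs_coeff_mul_apply_one_le`,
  `summable_abs_coeff_mul_apply_one_of_core` — the endpoint control and its summability;
* `contDiffOn_epsDensity_Ici_of_core`, `hasDerivWithinAt_epsDensity_zero_of_core`,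
  `hasSum_sonineQTerm_opQ_epsDensity_of_core`, `deriv_deriv_archDensity_zero_of_core`,
  `exists_contDiff_isArchDensity_of_core` (**K0 modulo the §4-only datum**), and the §5 file's named
  facts modulo it: `CC2021_lemma_5_4_of_core`, `CC2021_prop_5_3_of_core`, `CC2021_rem_5_6_of_core`;
* for THE prolate vectors `prolateFun` (seat t3's §4 vocabulary), via t6's
  `exists_isAppFDatum_prolateFun`: `exists_contDiff_isArchDensity_prolateFun` (**route item K0
  modulo exactly `CC2021_sec4_cosalphan` [PROVED], `CC2021_sec4_lambda_basic`,
  `CC2021_sec4_rapidDecay`**), `CC2021_lemma_5_4_of_sec4`, `CC2021_prop_5_3_of_sec4`,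
  `CC2021_rem_5_6_of_sec4`.

WHAT THIS IS NOT: no discharge of the §4 named facts `|λ| < 1`, (rapid-decay) — they remain
hypotheses; no numerical value of `ε′(1⁺)` (the printed `22.9965` still needs the small-`n` values
`ξ_n(1)`, a separate certified input); no statement about `ζ` or RH.
-/

noncomputable section

open Real MeasureTheory Set Filter intervalIntegral
open scoped Topology Nat

namespace Literature.NumberTheory.ConnesConsani2021

open Literature.NumberTheory.LFunctions Literature.Analysis.Calculus

/-! ## Elementary integral bounds -/

/-- `|∫_a^b ψ·F| ≤ M∫_a^b|ψ|` when `|F| ≤ M` on `[a,b]`. [folklore] -/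
private theorem abs_integral_mul_le {ψ F : ℝ → ℝ} {a b M : ℝ} (hab : a ≤ b)
    (hψ : IntervalIntegrable ψ volume a b) (hM : ∀ t ∈ Icc a b, |F t| ≤ M) :
    |∫ t in a..b, ψ t * F t| ≤ M * ∫ t in a..b, |ψ t| := by
  rw [← intervalIntegral.integral_const_mul, ← Real.norm_eq_abs]
  refine intervalIntegral.norm_integral_le_of_norm_le hab ?_ (hψ.abs.const_mul M)
  refine Eventually.of_forall fun t ht ↦ ?_
  rw [Real.norm_eq_abs, abs_mul, mul_comm]
  exact mul_le_mul_of_nonneg_right (hM t ⟨ht.1.le, ht.2⟩) (abs_nonneg _)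

/-! ## The App. F datum: basic consequences -/

section Datum

variable {n : ℕ} {ψ : ℝ → ℝ} {lam χ : ℝ}

/-- [Wang] weighted-`L²` constant `W₀(n) = (2n)² + (6π+1)(2n) + 3(2π+1)²` plus `χ + 4π²` is
dominated by `p(n)`: `W₀ + χ + 4π² ≤ 16n² + 300 ≤ remainderPoly n` (uses `χ < 2n(2n+1)+(2π)²`).
[cite: ConnesConsani2021, App. F Lemma F.1 (i) (arXiv Lemma 49), arXiv PDF p. 55 (chunk p0035:L39, L81)] -/
theorem IsAppFDatum.wangWeight_le_remainderPoly (d : IsAppFDatum n ψ lam χ) :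
    ((2 * (n : ℝ)) ^ 2 + (6 * π + 1) * (2 * n) + 3 * (2 * π + 1) ^ 2) + (χ + 4 * π ^ 2)
      ≤ remainderPoly n := by
  have h1 := (remainderPoly_lower n).1
  have hχ := d.eigen_lt
  have hπ := Real.pi_lt_d2
  have hπ0 := Real.pi_pos
  have hn : (0 : ℝ) ≤ n := Nat.cast_nonneg n
  nlinarith [sq_nonneg ((n : ℝ) - 21 / 8)]

/-- `λ(n) = prolateLambda ψ`: the datum's `lam` (from `η̃ = λψ` on `[−1,1]` at `x = 0`, `ψ(0) > 0`,
`ψ = 0` off `[−1,1]`) is seat t4's `(∫ψ)/ψ(0)`.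
[cite: ConnesConsani2021, §4 eq. (prolateeq) p. 16 (arXiv chunk p0016:L19–23)] -/
theorem IsAppFDatum.prolateLambda_eq (d : IsAppFDatum n ψ lam χ) :
    prolateLambda ψ = lam := by
  have h0 := d.cosTransform_eq 0 ⟨by norm_num, by norm_num⟩
  have hc : cosTransform ψ 0 = ∫ x in (-1 : ℝ)..1, ψ x := by
    simp [cosTransform]
  have hint : ∫ v, ψ v = ∫ x in (-1 : ℝ)..1, ψ x := by
    rw [intervalIntegral.integral_of_le (by norm_num), ← integral_Icc_eq_integral_Ioc,
      setIntegral_eq_integral_of_forall_compl_eq_zero]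
    intro x hx
    refine d.isProlate.support x ?_
    simp only [mem_Icc, not_and_or, not_le] at hx
    rcases hx with h | h
    · exact lt_abs.2 (Or.inr (by linarith))
    · exact lt_abs.2 (Or.inl h)
  have hpos : ψ 0 ≠ 0 := d.isProlate.pos_zero.ne'
  rw [prolateLambda, hint, ← hc, h0, mul_div_assoc, div_self hpos, mul_one]

/-- `1 − λ² > 0`. [cite: ConnesConsani2021, Prop. 4.5 (iii) §4 p. 16] -/
theorem IsAppFDatum.one_sub_sq_lam_pos (d : IsAppFDatum n ψ lam χ) :
    0 < 1 - lam ^ 2 := by linarith [d.sq_lam_lt]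

/-- `∫_a^1 |ψ| ≤ 99/70` for `0 ≤ a ≤ 1` (from `∫_{-1}^1ψ² = 1`).
[cite: ConnesConsani2021, App. F, chunk p0035:L16] -/
theorem IsAppFDatum.integral_abs_le (d : IsAppFDatum n ψ lam χ) {a : ℝ}
    (ha0 : 0 ≤ a) (ha1 : a ≤ 1) : ∫ x in a..1, |ψ x| ≤ 99 / 70 := by
  have hψc : ContinuousOn ψ (Icc (-1) 1) := by simpa using d.isProlate.contDiffOn.continuousOn
  have hnorm : ∫ x in (-1 : ℝ)..1, ψ x ^ 2 = 1 := by simpa using d.isProlate.norm_one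
  have i' : IntervalIntegrable (fun x ↦ |ψ x|) volume (-1) 1 := by
    apply ContinuousOn.intervalIntegrable; rw [uIcc_of_le (by norm_num)]; exact hψc.abs
  calc ∫ x in a..1, |ψ x| ≤ ∫ x in (-1 : ℝ)..1, |ψ x| :=
        intervalIntegral.integral_mono_interval (by linarith) ha1 le_rfl
          (Eventually.of_forall fun x ↦ abs_nonneg _) i'
    _ ≤ 99 / 70 := integral_abs_le_of_sq_one hψc hnorm

/-- `∫_a^1 |D_uψ| ≤ (37/70)·p(n)` for `0 ≤ a ≤ 1` (App. F `ξ`-side estimate on `[a,1]`, any `a`).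
[cite: ConnesConsani2021, App. F, chunk p0035:L24–L41] -/
theorem IsAppFDatum.integral_abs_scaleDerivIn_le (d : IsAppFDatum n ψ lam χ)
    {a : ℝ} (ha0 : 0 ≤ a) (ha1 : a ≤ 1) :
    ∫ x in a..1, |scaleDerivIn ψ x| ≤ 37 / 70 * remainderPoly n := by
  obtain ⟨hf, hf', hf''c, e1, e2⟩ := hasDerivWithinAt_package d.isProlate
  have hψc : ContinuousOn ψ (Icc (-1) 1) := fun x hx ↦ (hf x hx).continuousWithinAt
  have hf'c : ContinuousOn (derivWithin ψ (Icc (-1) 1)) (Icc (-1) 1) :=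
    fun x hx ↦ (hf' x hx).continuousWithinAt
  have hnorm : ∫ x in (-1 : ℝ)..1, ψ x ^ 2 = 1 := by simpa using d.isProlate.norm_one
  set W₀ : ℝ := (2 * (n : ℝ)) ^ 2 + (6 * π + 1) * (2 * n) + 3 * (2 * π + 1) ^ 2 with hW₀
  have hW₀pos : 0 < W₀ := by rw [hW₀]; positivity
  have hχ0 : 0 ≤ χ := by
    have := d.eigen_gt
    have hn : (0 : ℝ) ≤ n := Nat.cast_nonneg n
    nlinarith
  have hode := ode_Icc_of_eigen d.isProlate d.eigen
  have hwang' : ∫ x in (-1 : ℝ)..1,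
      ((1 - x ^ 2) * derivWithin (derivWithin ψ (Icc (-1) 1)) (Icc (-1) 1) x) ^ 2 ≤ W₀ ^ 2 := by
    have hfull : ∫ x in (-1 : ℝ)..1,
          ((1 - x ^ 2) * derivWithin (derivWithin ψ (Icc (-1) 1)) (Icc (-1) 1) x) ^ 2
        = ∫ x in (-1 : ℝ)..1, ((1 - x ^ 2) * deriv (deriv ψ) x) ^ 2 := by
      refine intervalIntegral.integral_congr_ae ?_
      have hae : ∀ᵐ x : ℝ, x ≠ 1 := by rw [ae_iff]; simp
      filter_upwards [hae] with x hx1 hx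
      rw [uIoc_of_le (by norm_num)] at hx
      rw [e2 x ⟨hx.1, lt_of_le_of_ne hx.2 hx1⟩]
    rw [hfull, hW₀]; exact d.wang
  have hL1 := integral_abs_mul_deriv_le_of_nonneg hψc hf'c hf''c hode hχ0 hW₀pos hwang' hnorm
    ha0 ha1
  have hp := d.wangWeight_le_remainderPoly
  calc ∫ x in a..1, |scaleDerivIn ψ x|
      = ∫ x in a..1, |x * derivWithin ψ (Icc (-1) 1) x| := by simp only [scaleDerivIn]
    _ ≤ 37 / 70 * (W₀ + (χ + 4 * π ^ 2)) := hL1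
    _ ≤ 37 / 70 * remainderPoly n := by rw [hW₀]; gcongr

end Datum

/-! ## Termwise sup bounds on `[0, L]` for the pieces of `g`, `g′`, `g″` (E3 displays) -/

section TermBounds

variable {n : ℕ} {ψ : ℝ → ℝ} {lam χ : ℝ}

/-- `|e^{x/2}∫_{e^{-x}}^1 ψ(t)η̃(e^x t)dt| ≤ e^{x/2}(99/70)²` (`|η̃| ≤ 99/70`, `∫|ψ| ≤ 99/70`).
[cite: ConnesConsani2021, App. F, chunk p0035:L16] -/
theorem IsAppFDatum.abs_kernel_le (d : IsAppFDatum n ψ lam χ) {x : ℝ} (hx : 0 ≤ x) :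
    |Real.exp (x / 2) * ∫ t in Real.exp (-x)..1, ψ t * cosTransform ψ (Real.exp x * t)|
      ≤ Real.exp (x / 2) * (99 / 70) ^ 2 := by
  have hψc : ContinuousOn ψ (Icc (-1) 1) := by simpa using d.isProlate.contDiffOn.continuousOn
  have hnorm : ∫ x in (-1 : ℝ)..1, ψ x ^ 2 = 1 := by simpa using d.isProlate.norm_one
  have ha0 : 0 ≤ Real.exp (-x) := (Real.exp_pos _).le
  have ha1 : Real.exp (-x) ≤ 1 := by rw [Real.exp_le_one_iff]; linarith
  have hψi : IntervalIntegrable ψ volume (Real.exp (-x)) 1 := by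
    apply ContinuousOn.intervalIntegrable; rw [uIcc_of_le ha1]
    exact hψc.mono (Icc_subset_Icc (by linarith) le_rfl)
  have h1 := abs_integral_mul_le (F := fun t ↦ cosTransform ψ (Real.exp x * t)) (M := 99 / 70)
    ha1 hψi (fun t _ ↦ abs_cosTransform_le hψc hnorm _)
  rw [abs_mul, abs_of_pos (Real.exp_pos _)]
  refine mul_le_mul_of_nonneg_left ?_ (Real.exp_pos _).le
  calc |∫ t in Real.exp (-x)..1, ψ t * cosTransform ψ (Real.exp x * t)|
      ≤ 99 / 70 * ∫ t in Real.exp (-x)..1, |ψ t| := h1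
    _ ≤ 99 / 70 * (99 / 70) :=
        mul_le_mul_of_nonneg_left (d.integral_abs_le ha0 ha1) (by norm_num)
    _ = (99 / 70) ^ 2 := by ring

/-- On `t ∈ [e^{-x}, 1]`: `|(D_uη̃)(e^x t)| ≤ e^x · 99π/35`.
[cite: ConnesConsani2021, App. F, chunk p0035:L55] -/
theorem IsAppFDatum.abs_scaleDeriv_cosTransform_le (d : IsAppFDatum n ψ lam χ)
    {x t : ℝ} (ht0 : 0 ≤ t) (ht1 : t ≤ 1) :
    |scaleDeriv (cosTransform ψ) (Real.exp x * t)| ≤ Real.exp x * (99 * π / 35) := by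
  have hψc : ContinuousOn ψ (Icc (-1) 1) := by simpa using d.isProlate.contDiffOn.continuousOn
  have hnorm : ∫ x in (-1 : ℝ)..1, ψ x ^ 2 = 1 := by simpa using d.isProlate.norm_one
  rw [scaleDeriv, abs_mul, abs_of_nonneg (by positivity)]
  have h1 : Real.exp x * t ≤ Real.exp x := mul_le_of_le_one_right (Real.exp_pos x).le ht1
  exact mul_le_mul h1 (abs_deriv_cosTransform_le hψc hnorm _) (abs_nonneg _) (Real.exp_pos x).le

/-- `|e^{x/2}∫_{e^{-x}}^1 ψ(t)(D_uη̃)(e^x t)dt| ≤ e^{x/2}·(e^x·99π/35)·(99/70)`.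
[cite: ConnesConsani2021, App. F, chunk p0035:L55] -/
theorem IsAppFDatum.abs_kernel_deriv_le (d : IsAppFDatum n ψ lam χ) {x : ℝ}
    (hx : 0 ≤ x) :
    |Real.exp (x / 2) * ∫ t in Real.exp (-x)..1, ψ t * scaleDeriv (cosTransform ψ) (Real.exp x * t)|
      ≤ Real.exp (x / 2) * (Real.exp x * (99 * π / 35)) * (99 / 70) := by
  have hψc : ContinuousOn ψ (Icc (-1) 1) := by simpa using d.isProlate.contDiffOn.continuousOn
  have ha0 : 0 ≤ Real.exp (-x) := (Real.exp_pos _).le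
  have ha1 : Real.exp (-x) ≤ 1 := by rw [Real.exp_le_one_iff]; linarith
  have hψi : IntervalIntegrable ψ volume (Real.exp (-x)) 1 := by
    apply ContinuousOn.intervalIntegrable; rw [uIcc_of_le ha1]
    exact hψc.mono (Icc_subset_Icc (by linarith) le_rfl)
  have h1 := abs_integral_mul_le (F := fun t ↦ scaleDeriv (cosTransform ψ) (Real.exp x * t))
    (M := Real.exp x * (99 * π / 35)) ha1 hψi
    (fun t ht ↦ d.abs_scaleDeriv_cosTransform_le (ha0.trans ht.1) ht.2)
  rw [abs_mul, abs_of_pos (Real.exp_pos _), mul_assoc]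
  refine mul_le_mul_of_nonneg_left ?_ (Real.exp_pos _).le
  exact h1.trans (mul_le_mul_of_nonneg_left (d.integral_abs_le ha0 ha1) (by positivity))

/-- The boundary term of `g′`: `|e^{-x/2}ψ(e^{-x})η̃(1)| ≤ (99/70)|ψ(1)|` (proportionality
`η̃ = λψ` on `[−1,1]` moves `λ` from `η̃(1) = λψ(1)` onto `ψ(e^{-x})`; NO bound on `ψ(1)` is used).
[cite: ConnesConsani2021, App. F, chunk p0035:L60–L70] -/
theorem IsAppFDatum.abs_boundary_one_le (d : IsAppFDatum n ψ lam χ) {x : ℝ}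
    (hx : 0 ≤ x) :
    |Real.exp (-x / 2) * ψ (Real.exp (-x)) * cosTransform ψ 1| ≤ 99 / 70 * |ψ 1| := by
  have hψc : ContinuousOn ψ (Icc (-1) 1) := by simpa using d.isProlate.contDiffOn.continuousOn
  have hnorm : ∫ x in (-1 : ℝ)..1, ψ x ^ 2 = 1 := by simpa using d.isProlate.norm_one
  have ha1 : Real.exp (-x) ≤ 1 := by rw [Real.exp_le_one_iff]; linarith
  have haI : Real.exp (-x) ∈ Icc (-1 : ℝ) 1 := ⟨by linarith [Real.exp_pos (-x)], ha1⟩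
  have h1 : cosTransform ψ 1 = lam * ψ 1 := d.cosTransform_eq 1 ⟨by norm_num, le_rfl⟩
  have ha : cosTransform ψ (Real.exp (-x)) = lam * ψ (Real.exp (-x)) := d.cosTransform_eq _ haI
  have key : Real.exp (-x / 2) * ψ (Real.exp (-x)) * cosTransform ψ 1 =
      Real.exp (-x / 2) * cosTransform ψ (Real.exp (-x)) * ψ 1 := by
    rw [h1, ha]; ring
  rw [key, abs_mul, abs_mul, abs_of_pos (Real.exp_pos _)]
  have he : Real.exp (-x / 2) ≤ 1 := by rw [Real.exp_le_one_iff]; linarith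
  calc Real.exp (-x / 2) * |cosTransform ψ (Real.exp (-x))| * |ψ 1|
      ≤ 1 * (99 / 70) * |ψ 1| :=
        mul_le_mul_of_nonneg_right
          (mul_le_mul he (abs_cosTransform_le hψc hnorm _) (abs_nonneg _) zero_le_one)
          (abs_nonneg _)
    _ = 99 / 70 * |ψ 1| := by ring

/-- `|e^{x/2}∫_{e^{-x}}^1 (D_uψ)(t)(D_uη̃)(e^x t)dt| ≤ e^{x/2}·(e^x·99π/35)·(37/70)p(n)`.
[cite: ConnesConsani2021, App. F eq. (boundAn), chunk p0035:L5–L45] -/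
theorem IsAppFDatum.abs_kernel_dd_le (d : IsAppFDatum n ψ lam χ) {x : ℝ}
    (hx : 0 ≤ x) :
    |Real.exp (x / 2) *
        ∫ t in Real.exp (-x)..1, scaleDerivIn ψ t * scaleDeriv (cosTransform ψ) (Real.exp x * t)|
      ≤ Real.exp (x / 2) * (Real.exp x * (99 * π / 35)) * (37 / 70 * remainderPoly n) := by
  obtain ⟨hf, hf', -, -, -⟩ := hasDerivWithinAt_package d.isProlate
  have hf'c : ContinuousOn (derivWithin ψ (Icc (-1) 1)) (Icc (-1) 1) :=
    fun x hx ↦ (hf' x hx).continuousWithinAt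
  have ha0 : 0 ≤ Real.exp (-x) := (Real.exp_pos _).le
  have ha1 : Real.exp (-x) ≤ 1 := by rw [Real.exp_le_one_iff]; linarith
  have hDi : IntervalIntegrable (scaleDerivIn ψ) volume (Real.exp (-x)) 1 := by
    apply ContinuousOn.intervalIntegrable; rw [uIcc_of_le ha1]
    exact ContinuousOn.mul (by fun_prop) (hf'c.mono (Icc_subset_Icc (by linarith) le_rfl))
  have h1 := abs_integral_mul_le (F := fun t ↦ scaleDeriv (cosTransform ψ) (Real.exp x * t))
    (M := Real.exp x * (99 * π / 35)) ha1 hDi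
    (fun t ht ↦ d.abs_scaleDeriv_cosTransform_le (ha0.trans ht.1) ht.2)
  rw [abs_mul, abs_of_pos (Real.exp_pos _), mul_assoc]
  refine mul_le_mul_of_nonneg_left ?_ (Real.exp_pos _).le
  exact h1.trans
    (mul_le_mul_of_nonneg_left (d.integral_abs_scaleDerivIn_le ha0 ha1) (by positivity))

/-- The first boundary term of `g″`: `|e^{-x/2}(D_uψ)(e^{-x})η̃(1)| ≤ (99π/35)|ψ(1)|`
(proportionality of the derivatives `λψ′ = η̃′` on `[−1,1]`; no bound on `ψ(1)` is used).
[cite: ConnesConsani2021, App. F eq. (boundBn), chunk p0035:L60–L74] -/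
theorem IsAppFDatum.abs_boundary_dd_one_le (d : IsAppFDatum n ψ lam χ) {x : ℝ}
    (hx : 0 ≤ x) :
    |Real.exp (-x / 2) * scaleDerivIn ψ (Real.exp (-x)) * cosTransform ψ 1|
      ≤ 99 * π / 35 * |ψ 1| := by
  have hψc : ContinuousOn ψ (Icc (-1) 1) := by simpa using d.isProlate.contDiffOn.continuousOn
  have hnorm : ∫ x in (-1 : ℝ)..1, ψ x ^ 2 = 1 := by simpa using d.isProlate.norm_one
  have ha1 : Real.exp (-x) ≤ 1 := by rw [Real.exp_le_one_iff]; linarith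
  have haI : Real.exp (-x) ∈ Icc (-1 : ℝ) 1 := ⟨by linarith [Real.exp_pos (-x)], ha1⟩
  have h1 : cosTransform ψ 1 = lam * ψ 1 := d.cosTransform_eq 1 ⟨by norm_num, le_rfl⟩
  have ha := d.lam_mul_derivWithin_F haI
  have key : Real.exp (-x / 2) * scaleDerivIn ψ (Real.exp (-x)) * cosTransform ψ 1 =
      Real.exp (-x / 2) * Real.exp (-x) * deriv (cosTransform ψ) (Real.exp (-x)) * ψ 1 := by
    rw [h1, scaleDerivIn, ← ha]; ring
  rw [key, abs_mul, abs_mul, abs_mul, abs_of_pos (Real.exp_pos _), abs_of_pos (Real.exp_pos _)]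
  have he : Real.exp (-x / 2) ≤ 1 := by rw [Real.exp_le_one_iff]; linarith
  have hK := abs_deriv_cosTransform_le hψc hnorm (Real.exp (-x))
  calc Real.exp (-x / 2) * Real.exp (-x) * |deriv (cosTransform ψ) (Real.exp (-x))| * |ψ 1|
      ≤ 1 * 1 * (99 * π / 35) * |ψ 1| := by
        refine mul_le_mul_of_nonneg_right (mul_le_mul (mul_le_mul he ha1 (Real.exp_pos _).le
          zero_le_one) hK (abs_nonneg _) (by positivity)) (abs_nonneg _)
    _ = 99 * π / 35 * |ψ 1| := by ring

/-- The second boundary term of `g″`: `|e^{x/2}ψ(1)(D_uη̃)(e^x)| ≤ e^{x/2}|ψ(1)|(e^x·99π/35)`.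
[cite: ConnesConsani2021, App. F eq. (boundBn), chunk p0035:L49–L60] -/
theorem IsAppFDatum.abs_boundary_dd_two_le (d : IsAppFDatum n ψ lam χ) (x : ℝ) :
    |Real.exp (x / 2) * ψ 1 * scaleDeriv (cosTransform ψ) (Real.exp x)|
      ≤ Real.exp (x / 2) * |ψ 1| * (Real.exp x * (99 * π / 35)) := by
  have h := d.abs_scaleDeriv_cosTransform_le (x := x) (t := 1) zero_le_one le_rfl
  rw [mul_one] at h
  rw [abs_mul, abs_mul, abs_of_pos (Real.exp_pos _)]
  exact mul_le_mul_of_nonneg_left h (by positivity)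

/-- **Termwise sup-majorant on `[0, L]`.**  For the Lemma 5.2 function `g` of the datum (the E3
displays: `g`, `g′`, `−g″ + g/4`), every `x ∈ [0, L]` and `k ≤ 2`:
`|g^{(k)}(x)| ≤ R_L(n)` with the explicit
`R_L(n) = M(99/70)² + M²K(99/70) + (99/70)s + M²K(37/70)p(n) + Ks + M²Ks`, `M = e^L`, `K = 99π/35`,
`s = |ψ(1)|` (kept explicit: no endpoint bound is used) — the general-`L` form of App. F's bounds
(printed for `ρ = e^x ≤ 2`).
[cite: ConnesConsani2021, App. F Lemma F.1 (i) (arXiv Lemma 49) eqs. (boundAn)/(boundBn), arXiv PDF pp. 54–55 (chunk p0035:L5–L92)] -/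
theorem IsAppFDatum.abs_derivs_le (d : IsAppFDatum n ψ lam χ) {L : ℝ} {g : ℝ → ℝ}
    (hg0 : ∀ x, 0 ≤ x →
      g x = Real.exp (x / 2) * ∫ t in Real.exp (-x)..1, ψ t * cosTransform ψ (Real.exp x * t))
    (hg1 : ∀ x, 0 ≤ x →
      deriv g x = g x / 2
        + Real.exp (x / 2) *
            (∫ t in Real.exp (-x)..1, ψ t * scaleDeriv (cosTransform ψ) (Real.exp x * t))
        + Real.exp (-x / 2) * ψ (Real.exp (-x)) * cosTransform ψ 1)
    (hg2 : ∀ x, 0 ≤ x →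
      -deriv (deriv g) x + g x / 4 =
        Real.exp (x / 2) *
            (∫ t in Real.exp (-x)..1,
              scaleDerivIn ψ t * scaleDeriv (cosTransform ψ) (Real.exp x * t))
          + Real.exp (-x / 2) * scaleDerivIn ψ (Real.exp (-x)) * cosTransform ψ 1
          - Real.exp (x / 2) * ψ 1 * scaleDeriv (cosTransform ψ) (Real.exp x))
    {x : ℝ} (hx : x ∈ Icc 0 L) :
    |g x| ≤ Real.exp L * (99 / 70) ^ 2 + Real.exp L ^ 2 * (99 * π / 35) * (99 / 70)
        + 99 / 70 * |ψ 1|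
        + Real.exp L ^ 2 * (99 * π / 35) * (37 / 70 * remainderPoly n)
        + 99 * π / 35 * |ψ 1|
        + Real.exp L ^ 2 * (99 * π / 35) * |ψ 1| ∧
      |deriv g x| ≤ Real.exp L * (99 / 70) ^ 2 + Real.exp L ^ 2 * (99 * π / 35) * (99 / 70)
        + 99 / 70 * |ψ 1|
        + Real.exp L ^ 2 * (99 * π / 35) * (37 / 70 * remainderPoly n)
        + 99 * π / 35 * |ψ 1|
        + Real.exp L ^ 2 * (99 * π / 35) * |ψ 1| ∧
      |deriv (deriv g) x| ≤ Real.exp L * (99 / 70) ^ 2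
        + Real.exp L ^ 2 * (99 * π / 35) * (99 / 70)
        + 99 / 70 * |ψ 1|
        + Real.exp L ^ 2 * (99 * π / 35) * (37 / 70 * remainderPoly n)
        + 99 * π / 35 * |ψ 1|
        + Real.exp L ^ 2 * (99 * π / 35) * |ψ 1| := by
  have hx0 : 0 ≤ x := hx.1
  have hπ := Real.pi_pos
  set M : ℝ := Real.exp L with hM
  set K : ℝ := 99 * π / 35 with hK
  set s : ℝ := |ψ 1| with hs
  set p : ℝ := remainderPoly n with hp
  have hK0 : 0 < K := by rw [hK]; positivity
  have hs0 : 0 ≤ s := abs_nonneg _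
  have hp0 : 0 < p := remainderPoly_pos n
  have hM1 : 1 ≤ M := by rw [hM]; exact Real.one_le_exp hx0 |>.trans (Real.exp_le_exp.2 hx.2)
  have he1 : Real.exp (x / 2) ≤ M := Real.exp_le_exp.2 (by linarith [hx.2])
  have he2 : Real.exp x ≤ M := Real.exp_le_exp.2 hx.2
  have he3 : Real.exp (x / 2) * Real.exp x ≤ M ^ 2 := by
    rw [sq]; exact mul_le_mul he1 he2 (Real.exp_pos _).le (by positivity)
  -- the six pieces
  have b0 := d.abs_kernel_le hx0
  have b1 := d.abs_kernel_deriv_le hx0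
  have b2 := d.abs_boundary_one_le hx0
  have b3 := d.abs_kernel_dd_le hx0
  have b4 := d.abs_boundary_dd_one_le hx0
  have b5 := d.abs_boundary_dd_two_le x
  rw [← hg0 x hx0] at b0
  -- |g|
  have hg : |g x| ≤ M * (99 / 70) ^ 2 :=
    b0.trans (mul_le_mul_of_nonneg_right he1 (by positivity))
  have hB1 : |Real.exp (x / 2) *
      ∫ t in Real.exp (-x)..1, ψ t * scaleDeriv (cosTransform ψ) (Real.exp x * t)|
        ≤ M ^ 2 * K * (99 / 70) := by
    refine b1.trans ?_
    have e : Real.exp (x / 2) * (Real.exp x * (99 * π / 35)) * (99 / 70) =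
        (Real.exp (x / 2) * Real.exp x) * K * (99 / 70) := by rw [hK]; ring
    rw [e]
    exact mul_le_mul_of_nonneg_right (mul_le_mul_of_nonneg_right he3 hK0.le) (by norm_num)
  have hB3 : |Real.exp (x / 2) *
      ∫ t in Real.exp (-x)..1, scaleDerivIn ψ t * scaleDeriv (cosTransform ψ) (Real.exp x * t)|
        ≤ M ^ 2 * K * (37 / 70 * p) := by
    refine b3.trans ?_
    have e : Real.exp (x / 2) * (Real.exp x * (99 * π / 35)) * (37 / 70 * remainderPoly n) =
        (Real.exp (x / 2) * Real.exp x) * K * (37 / 70 * p) := by rw [hK, hp]; ring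
    rw [e]
    exact mul_le_mul_of_nonneg_right (mul_le_mul_of_nonneg_right he3 hK0.le) (by positivity)
  have hB5 : |Real.exp (x / 2) * ψ 1 * scaleDeriv (cosTransform ψ) (Real.exp x)|
      ≤ M ^ 2 * K * s := by
    refine b5.trans ?_
    have : Real.exp (x / 2) * s * (Real.exp x * K) = (Real.exp (x / 2) * Real.exp x) * K * s := by
      ring
    rw [this]
    exact mul_le_mul_of_nonneg_right (mul_le_mul_of_nonneg_right he3 hK0.le) hs0
  -- nonnegativity of the pieces of `R`
  have t0 : 0 ≤ M * (99 / 70) ^ 2 := by positivity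
  have t1 : 0 ≤ M ^ 2 * K * (99 / 70) := by positivity
  have t2 : 0 ≤ 99 / 70 * s := by positivity
  have t3 : 0 ≤ M ^ 2 * K * (37 / 70 * p) := by positivity
  have t4 : 0 ≤ K * s := by positivity
  have t5 : 0 ≤ M ^ 2 * K * s := by positivity
  refine ⟨by linarith, ?_, ?_⟩
  · rw [hg1 x hx0]
    calc |g x / 2 + Real.exp (x / 2) *
          (∫ t in Real.exp (-x)..1, ψ t * scaleDeriv (cosTransform ψ) (Real.exp x * t))
          + Real.exp (-x / 2) * ψ (Real.exp (-x)) * cosTransform ψ 1|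
        ≤ |g x / 2| + |Real.exp (x / 2) *
          (∫ t in Real.exp (-x)..1, ψ t * scaleDeriv (cosTransform ψ) (Real.exp x * t))|
          + |Real.exp (-x / 2) * ψ (Real.exp (-x)) * cosTransform ψ 1| := abs_add_three _ _ _
      _ ≤ M * (99 / 70) ^ 2 / 2 + M ^ 2 * K * (99 / 70) + 99 / 70 * s := by
          rw [abs_div, abs_two]
          exact add_le_add (add_le_add (by linarith) hB1) b2
      _ ≤ _ := by nlinarith
  · have e : deriv (deriv g) x = g x / 4 -
        (Real.exp (x / 2) *
            (∫ t in Real.exp (-x)..1,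
              scaleDerivIn ψ t * scaleDeriv (cosTransform ψ) (Real.exp x * t))
          + Real.exp (-x / 2) * scaleDerivIn ψ (Real.exp (-x)) * cosTransform ψ 1
          - Real.exp (x / 2) * ψ 1 * scaleDeriv (cosTransform ψ) (Real.exp x)) := by
      linarith [hg2 x hx0]
    rw [e]
    calc |g x / 4 -
        (Real.exp (x / 2) *
            (∫ t in Real.exp (-x)..1,
              scaleDerivIn ψ t * scaleDeriv (cosTransform ψ) (Real.exp x * t))
          + Real.exp (-x / 2) * scaleDerivIn ψ (Real.exp (-x)) * cosTransform ψ 1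
          - Real.exp (x / 2) * ψ 1 * scaleDeriv (cosTransform ψ) (Real.exp x))|
        ≤ |g x / 4| + |Real.exp (x / 2) *
            (∫ t in Real.exp (-x)..1,
              scaleDerivIn ψ t * scaleDeriv (cosTransform ψ) (Real.exp x * t))
          + Real.exp (-x / 2) * scaleDerivIn ψ (Real.exp (-x)) * cosTransform ψ 1
          - Real.exp (x / 2) * ψ 1 * scaleDeriv (cosTransform ψ) (Real.exp x)| := abs_sub _ _
      _ ≤ |g x / 4| + (|Real.exp (x / 2) *
            (∫ t in Real.exp (-x)..1,
              scaleDerivIn ψ t * scaleDeriv (cosTransform ψ) (Real.exp x * t))|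
          + |Real.exp (-x / 2) * scaleDerivIn ψ (Real.exp (-x)) * cosTransform ψ 1|
          + |Real.exp (x / 2) * ψ 1 * scaleDeriv (cosTransform ψ) (Real.exp x)|) := by
          gcongr
          exact (abs_sub _ _).trans (add_le_add (abs_add_le _ _) le_rfl)
      _ ≤ M * (99 / 70) ^ 2 / 4 + (M ^ 2 * K * (37 / 70 * p) + K * s + M ^ 2 * K * s) := by
          rw [abs_div, show |(4 : ℝ)| = 4 by norm_num]
          exact add_le_add (by linarith) (add_le_add (add_le_add hB3 b4) hB5)
      _ ≤ _ := by nlinarith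

end TermBounds

/-! ## From the explicit majorant to `A(L)·p(n)` and a summable series of majorants -/

section Majorant

variable {n : ℕ} {ψ : ℝ → ℝ} {lam χ : ℝ}

/-- **Termwise sup-majorant on `[0, L]`, polynomial form with the endpoint value explicit**:
`|g^{(k)}(x)| ≤ A₁(L)·p(n) + A₂(L)·|ψ(1)|` for `k ≤ 2`, `x ∈ [0,L]`, with
`A₁(L) = e^{2L}((99/70)² + (99π/35)(99/70) + 99π/35)`, `A₂(L) = e^{2L}(99/70 + 2·99π/35)`,
`p(n) = remainderPoly n` (polynomial factors absorbed by `p(n) ≥ 16n² + 300`).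
[cite: ConnesConsani2021, App. F Lemma F.1 (i) (arXiv Lemma 49), arXiv PDF p. 55 (chunk p0035:L78–L92)] -/
theorem IsAppFDatum.abs_derivs_le_poly (d : IsAppFDatum n ψ lam χ) {L : ℝ}
    {g : ℝ → ℝ}
    (hg0 : ∀ x, 0 ≤ x →
      g x = Real.exp (x / 2) * ∫ t in Real.exp (-x)..1, ψ t * cosTransform ψ (Real.exp x * t))
    (hg1 : ∀ x, 0 ≤ x →
      deriv g x = g x / 2
        + Real.exp (x / 2) *
            (∫ t in Real.exp (-x)..1, ψ t * scaleDeriv (cosTransform ψ) (Real.exp x * t))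
        + Real.exp (-x / 2) * ψ (Real.exp (-x)) * cosTransform ψ 1)
    (hg2 : ∀ x, 0 ≤ x →
      -deriv (deriv g) x + g x / 4 =
        Real.exp (x / 2) *
            (∫ t in Real.exp (-x)..1,
              scaleDerivIn ψ t * scaleDeriv (cosTransform ψ) (Real.exp x * t))
          + Real.exp (-x / 2) * scaleDerivIn ψ (Real.exp (-x)) * cosTransform ψ 1
          - Real.exp (x / 2) * ψ 1 * scaleDeriv (cosTransform ψ) (Real.exp x))
    {x : ℝ} (hx : x ∈ Icc 0 L) :
    |g x| ≤ Real.exp L ^ 2 * ((99 / 70) ^ 2 + 99 * π / 35 * (99 / 70) + 99 * π / 35)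
          * remainderPoly n
        + Real.exp L ^ 2 * (99 / 70 + 2 * (99 * π / 35)) * |ψ 1| ∧
      |deriv g x| ≤ Real.exp L ^ 2 * ((99 / 70) ^ 2 + 99 * π / 35 * (99 / 70) + 99 * π / 35)
          * remainderPoly n
        + Real.exp L ^ 2 * (99 / 70 + 2 * (99 * π / 35)) * |ψ 1| ∧
      |deriv (deriv g) x| ≤
        Real.exp L ^ 2 * ((99 / 70) ^ 2 + 99 * π / 35 * (99 / 70) + 99 * π / 35)
          * remainderPoly n
        + Real.exp L ^ 2 * (99 / 70 + 2 * (99 * π / 35)) * |ψ 1| := by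
  obtain ⟨h0, h1, h2⟩ := d.abs_derivs_le hg0 hg1 hg2 hx
  set M : ℝ := Real.exp L with hM
  set K : ℝ := 99 * π / 35 with hK
  set s : ℝ := |ψ 1| with hs
  set p : ℝ := remainderPoly n with hp
  have hK0 : 0 < K := by rw [hK]; positivity
  have hs0 : 0 ≤ s := abs_nonneg _
  have hM1 : 1 ≤ M := by
    rw [hM]; exact Real.one_le_exp hx.1 |>.trans (Real.exp_le_exp.2 hx.2)
  have hp1 : 1 ≤ p := by
    have := (remainderPoly_lower n).1
    rw [hp]; nlinarith [sq_nonneg (n : ℝ)]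
  have hM2 : M ≤ M ^ 2 := by nlinarith
  have hM2p : M ^ 2 ≤ M ^ 2 * p := le_mul_of_one_le_right (by positivity) hp1
  have hX1 : M ≤ M ^ 2 * p := hM2.trans hM2p
  have hM21 : 1 ≤ M ^ 2 := by nlinarith
  have hR : M * (99 / 70) ^ 2 + M ^ 2 * K * (99 / 70) + 99 / 70 * s
        + M ^ 2 * K * (37 / 70 * p) + K * s + M ^ 2 * K * s
      ≤ M ^ 2 * ((99 / 70) ^ 2 + K * (99 / 70) + K) * p + M ^ 2 * (99 / 70 + 2 * K) * s := by
    have a1 : M * (99 / 70) ^ 2 ≤ (99 / 70) ^ 2 * (M ^ 2 * p) := by nlinarith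
    have a2 : M ^ 2 * K * (99 / 70) ≤ K * (99 / 70) * (M ^ 2 * p) := by nlinarith
    have a3 : 99 / 70 * s ≤ 99 / 70 * (M ^ 2 * s) := by nlinarith
    have a4 : M ^ 2 * K * (37 / 70 * p) ≤ K * (M ^ 2 * p) := by
      nlinarith [mul_pos hK0 (by positivity : (0:ℝ) < M ^ 2 * p)]
    have a5 : K * s ≤ K * (M ^ 2 * s) :=
      mul_le_mul_of_nonneg_left (le_mul_of_one_le_left hs0 hM21) hK0.le
    nlinarith
  exact ⟨h0.trans hR, h1.trans hR, h2.trans hR⟩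

/-! ## The endpoint value `ψ(1)` needs NO prolate input: the ODE at `x = 1` and (74)′ -/

/-- **Endpoint control, free of [Rokhlin–Xiao] Thm 12**: the prolate equation at the
regular-singular endpoint `x = 1` reads `2ψ′(1) = (χ − 4π²)ψ(1)` (the `(1−x²)ψ″` term drops,
`ode_Icc_of_eigen`), and
(74)′ `λψ′ = η̃′` on `[−1,1]` with `|η̃′| ≤ 99π/35` gives `|λ|·|χ − 4π²|·|ψ(1)| ≤ 2·99π/35`.
[cite: ConnesConsani2021, App. F, chunk p0035:L27–L33 (the equation (WLambdaq) on [−1,1]) and L60–L62 (proportionality)] -/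
theorem IsAppFDatum.abs_lam_mul_apply_one_le (d : IsAppFDatum n ψ lam χ) :
    |lam| * |χ - 4 * π ^ 2| * |ψ 1| ≤ 2 * (99 * π / 35) := by
  have hψc : ContinuousOn ψ (Icc (-1) 1) := by simpa using d.isProlate.contDiffOn.continuousOn
  have hnorm : ∫ x in (-1 : ℝ)..1, ψ x ^ 2 = 1 := by simpa using d.isProlate.norm_one
  have h1 : (1 : ℝ) ∈ Icc (-1 : ℝ) 1 := ⟨by norm_num, le_rfl⟩
  have hode := ode_Icc_of_eigen d.isProlate d.eigen 1 h1
  have hlam := d.lam_mul_derivWithin_F h1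
  have hK := abs_deriv_cosTransform_le hψc hnorm 1
  -- `ψ′(1) = (χ − 4π²)ψ(1)/2`
  have hd : derivWithin ψ (Icc (-1) 1) 1 = (χ - 4 * π ^ 2) * ψ 1 / 2 := by
    have : (1 - (1:ℝ) ^ 2) = 0 := by norm_num
    rw [this, zero_mul] at hode
    linear_combination (-1 / 2 : ℝ) * hode
  have key : lam * ((χ - 4 * π ^ 2) * ψ 1) = 2 * deriv (cosTransform ψ) 1 := by
    rw [← hlam, hd]; ring
  calc |lam| * |χ - 4 * π ^ 2| * |ψ 1| = |lam * ((χ - 4 * π ^ 2) * ψ 1)| := by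
        rw [abs_mul, abs_mul, mul_assoc]
    _ = 2 * |deriv (cosTransform ψ) 1| := by rw [key, abs_mul, abs_two]
    _ ≤ 2 * (99 * π / 35) := by linarith

/-- The coefficient of the `n`-th `ε`-term: `|2λ/(1−λ²)| ≤ (80000/39831)·r(n)` (`n ≥ 3`), as in
the full datum.
[cite: ConnesConsani2021, App. F Lemma F.1 (arXiv Lemma 49) proof, arXiv PDF p. 55 (chunk p0035:L87–L92)] -/
theorem IsAppFDatum.abs_coeff_le (d : IsAppFDatum n ψ lam χ) (hn : 3 ≤ n) :
    |2 * lam / (1 - lam ^ 2)| ≤ 80000 / 39831 * (remainderTerm n / (4 * π * remainderPoly n)) := by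
  obtain ⟨hr, hlam2⟩ := d.abs_lam_le_const_F hn
  have h1l : 0 < 1 - lam ^ 2 := by linarith [d.sq_lam_lt]
  rw [abs_div, abs_mul, abs_two, abs_of_pos h1l, div_le_iff₀ h1l]
  have h0 : 0 ≤ remainderTerm n / (4 * π * remainderPoly n) := le_trans (abs_nonneg _) hr
  nlinarith [hr, hlam2, h0]

/-- **The weighted endpoint values are `O(1/n²)`**: for `n ≥ 3`,
`|2λ/(1−λ²)|·|ψ(1)| ≤ (80000/39831)·(198π/35)/(2n(2n+1) − 4π²)` (endpoint control + [Wang] (2.6)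
`χ > 2n(2n+1)`, so `χ − 4π² ≥ 2n(2n+1) − 4π² > 0`).
[cite: ConnesConsani2021, App. F, chunk p0035:L27–L41 and L60–L74] -/
theorem IsAppFDatum.abs_coeff_mul_apply_one_le (d : IsAppFDatum n ψ lam χ)
    (hn : 3 ≤ n) :
    |2 * lam / (1 - lam ^ 2)| * |ψ 1|
      ≤ 80000 / 39831 * (2 * (99 * π / 35)) / (2 * (n : ℝ) * (2 * n + 1) - 4 * π ^ 2) := by
  have hπ := Real.pi_lt_d2
  have hπ0 := Real.pi_pos
  have hn' : (3 : ℝ) ≤ n := by exact_mod_cast hn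
  have hD0 : 0 < 2 * (n : ℝ) * (2 * n + 1) - 4 * π ^ 2 := by nlinarith
  have hχ : 2 * (n : ℝ) * (2 * n + 1) - 4 * π ^ 2 ≤ χ - 4 * π ^ 2 := by linarith [d.eigen_gt]
  have hχ0 : 0 < χ - 4 * π ^ 2 := lt_of_lt_of_le hD0 hχ
  have hend := d.abs_lam_mul_apply_one_le
  rw [abs_of_pos hχ0] at hend
  obtain ⟨-, hlam2⟩ := d.abs_lam_le_const_F hn
  have h1l : 0 < 1 - lam ^ 2 := by linarith [d.sq_lam_lt]
  have hcoef : |2 * lam / (1 - lam ^ 2)| = 2 * |lam| / (1 - lam ^ 2) := by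
    rw [abs_div, abs_mul, abs_two, abs_of_pos h1l]
  -- `|λ|·|ψ(1)| ≤ (198π/35)/(χ − 4π²) ≤ (198π/35)/(2n(2n+1) − 4π²)`
  have hprod : |lam| * |ψ 1| ≤ 2 * (99 * π / 35) / (2 * (n : ℝ) * (2 * n + 1) - 4 * π ^ 2) := by
    rw [le_div_iff₀ hD0]
    calc |lam| * |ψ 1| * (2 * (n : ℝ) * (2 * n + 1) - 4 * π ^ 2)
        ≤ |lam| * |ψ 1| * (χ - 4 * π ^ 2) :=
          mul_le_mul_of_nonneg_left hχ (mul_nonneg (abs_nonneg _) (abs_nonneg _))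
      _ = |lam| * (χ - 4 * π ^ 2) * |ψ 1| := by ring
      _ ≤ 2 * (99 * π / 35) := hend
  have hinv : 2 / (1 - lam ^ 2) ≤ 80000 / 39831 := by
    rw [div_le_iff₀ h1l]; nlinarith
  have h2pos : 0 ≤ 2 / (1 - lam ^ 2) := by positivity
  calc |2 * lam / (1 - lam ^ 2)| * |ψ 1| = 2 / (1 - lam ^ 2) * (|lam| * |ψ 1|) := by
        rw [hcoef]; ring
    _ ≤ 80000 / 39831 * (2 * (99 * π / 35) / (2 * (n : ℝ) * (2 * n + 1) - 4 * π ^ 2)) :=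
        mul_le_mul hinv hprod (mul_nonneg (abs_nonneg _) (abs_nonneg _)) (by norm_num)
    _ = _ := by ring

end Majorant


/-! ## The sum: `ε ∘ exp` is `C²` on `[0, ∞)`, extends to a `C²` function on `ℝ`, slope at `0⁺` -/

section Assembly

variable {ψ : ℕ → ℝ → ℝ} {lam χ : ℕ → ℝ}

/-- The series of majorants `Σ_n |2λ(n)/(1−λ(n)²)|·A(L)p(n)` converges (by (rapid-decay):
`|2λ/(1−λ²)|·p(n) ≤ const·a(n)` for `n ≥ 3`, `Σ a(n) < ∞`).
[cite: ConnesConsani2021, App. F Lemma F.1 (i) (arXiv Lemma 49) eq. (computersafe), arXiv PDF p. 55 (chunk p0035:L78–L81)] -/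
theorem summable_abs_coeff_mul_remainderPoly_of_core
    (d : ∀ n, IsAppFDatum n (ψ n) (lam n) (χ n)) (A : ℝ) :
    Summable (fun n ↦ |2 * lam n / (1 - lam n ^ 2)| * (A * remainderPoly n)) := by
  have hB : Summable (fun n ↦ 80000 / 39831 * |A| / (4 * π) * remainderTerm n) :=
    summable_remainderTerm.mul_left _
  refine Summable.of_norm_bounded_eventually_nat hB ?_
  filter_upwards [eventually_ge_atTop 3] with n hn
  have hc := (d n).abs_coeff_le hn
  have hp0 : 0 < remainderPoly n := remainderPoly_pos n
  have hπ := Real.pi_pos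
  rw [Real.norm_eq_abs, abs_mul, abs_abs, abs_mul]
  calc |2 * lam n / (1 - lam n ^ 2)| * (|A| * |remainderPoly n|)
      ≤ 80000 / 39831 * (remainderTerm n / (4 * π * remainderPoly n)) * (|A| * |remainderPoly n|) :=
        mul_le_mul_of_nonneg_right hc (by positivity)
    _ = 80000 / 39831 * |A| / (4 * π) * remainderTerm n := by
        rw [abs_of_pos hp0]; field_simp

/-- The series of weighted endpoint values `Σ_n B·|2λ(n)/(1−λ(n)²)|·|ψ_n(1)|` converges — with
NO endpoint input: `O(1/n²)` by `abs_coeff_mul_apply_one_le` (`2n(2n+1) − 4π² ≥ 2n²` for `n ≥ 4`).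
[cite: ConnesConsani2021, App. F, chunk p0035:L60–L74; Lemma 5.4 §5 p. 33 ("the convergence of the series")] -/
theorem summable_abs_coeff_mul_apply_one_of_core
    (d : ∀ n, IsAppFDatum n (ψ n) (lam n) (χ n)) (B : ℝ) :
    Summable (fun n ↦ B * (|2 * lam n / (1 - lam n ^ 2)| * |ψ n 1|)) := by
  refine Summable.mul_left B ?_
  have hπ := Real.pi_lt_d2
  have hπ0 := Real.pi_pos
  set C : ℝ := 80000 / 39831 * (2 * (99 * π / 35)) with hC
  have hC0 : 0 ≤ C := by rw [hC]; positivity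
  have hB : Summable (fun n : ℕ ↦ C / 2 * ((n : ℝ) ^ 2)⁻¹) :=
    (Real.summable_nat_pow_inv.2 one_lt_two).mul_left _
  refine Summable.of_norm_bounded_eventually_nat hB ?_
  filter_upwards [eventually_ge_atTop 4] with n hn
  have hn' : (4 : ℝ) ≤ n := by exact_mod_cast hn
  have h3 : 3 ≤ n := le_trans (by norm_num) hn
  have hc := (d n).abs_coeff_mul_apply_one_le h3
  have hD : 2 * (n : ℝ) ^ 2 ≤ 2 * (n : ℝ) * (2 * n + 1) - 4 * π ^ 2 := by nlinarith
  have hn2 : 0 < 2 * (n : ℝ) ^ 2 := by positivity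
  rw [Real.norm_eq_abs, abs_mul, abs_abs, abs_abs]
  calc |2 * lam n / (1 - lam n ^ 2)| * |ψ n 1|
      ≤ C / (2 * (n : ℝ) * (2 * n + 1) - 4 * π ^ 2) := by rw [hC]; exact hc
    _ ≤ C / (2 * (n : ℝ) ^ 2) := div_le_div_of_nonneg_left hC0 hn2 hD
    _ = C / 2 * ((n : ℝ) ^ 2)⁻¹ := by ring

/-- `iteratedDerivWithin` commutes with the cast `ℝ → ℂ`. [folklore] -/
private theorem iteratedDerivWithin_ofReal_comp {f : ℝ → ℝ} {s : Set ℝ} {x : ℝ} {k n : ℕ}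
    (hf : ContDiffOn ℝ n f s) (hs : UniqueDiffOn ℝ s) (hx : x ∈ s) (hk : k ≤ n) :
    iteratedDerivWithin k (fun t ↦ ((f t : ℝ) : ℂ)) s x =
      ((iteratedDerivWithin k f s x : ℝ) : ℂ) := by
  have h := Complex.ofRealCLM.iteratedFDerivWithin_comp_left (hf x hx) hs hx (i := k)
    (by exact_mod_cast hk)
  have hc : (fun t ↦ ((f t : ℝ) : ℂ)) = Complex.ofRealCLM ∘ f := rfl
  rw [iteratedDerivWithin, iteratedDerivWithin, hc, h]
  rfl

/-- The package behind the theorems below: the Lemma 5.2 functions `g_n` of the terms, the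
identities tying them to `epsTerm`, `epsSlopeTerm`, `sonineQTerm`, and the `C²` M-test on every
`[0, L]` with termwise derivatives. [folklore] -/
private theorem archDensityCore_package (d : ∀ n, IsAppFDatum n (ψ n) (lam n) (χ n)) :
    ∃ g : ℕ → ℝ → ℝ,
      (∀ n, ContDiff ℝ 2 (g n)) ∧
      (∀ n x, 0 ≤ x → epsTerm (ψ n) x = ((2 * lam n / (1 - lam n ^ 2) * g n x : ℝ) : ℂ)) ∧
      (∀ n, g n 0 = 0) ∧
      (∀ n, 2 * lam n / (1 - lam n ^ 2) * deriv (g n) 0 = epsSlopeTerm (ψ n)) ∧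
      (∀ n x, 0 ≤ x → 2 * lam n / (1 - lam n ^ 2) * (-deriv (deriv (g n)) x + g n x / 4)
          = sonineQTerm (ψ n) (lam n) (Real.exp x)) ∧
      (∀ L, 0 < L →
        ContDiffOn ℝ 2 (fun x ↦ ∑' n, 2 * lam n / (1 - lam n ^ 2) * g n x) (Icc 0 L) ∧
        ∀ k, k ≤ 2 → ∀ x ∈ Icc 0 L,
          Summable (fun n ↦ 2 * lam n / (1 - lam n ^ 2) * iteratedDeriv k (g n) x) ∧
          iteratedDerivWithin k (fun x ↦ ∑' n, 2 * lam n / (1 - lam n ^ 2) * g n x) (Icc 0 L) x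
            = ∑' n, 2 * lam n / (1 - lam n ^ 2) * iteratedDeriv k (g n) x) := by
  -- the Lemma 5.2 functions of the terms
  have hξ : ∀ n, ContDiffOn ℝ 2 (ψ n) (Icc (-1) 1) := fun n ↦ by
    simpa using (d n).isProlate.contDiffOn
  have hη : ∀ n, ContDiff ℝ 2 (cosTransform (ψ n)) := fun n ↦
    contDiff_two_cosTransform_of_isProlateFunction (d n).isProlate
  choose g hg using fun n ↦ exists_contDiff_truncScalingCoeff (hξ n) (hη n)
  set c : ℕ → ℝ := fun n ↦ 2 * lam n / (1 - lam n ^ 2) with hc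
  set A₁ : ℝ → ℝ := fun L ↦
    Real.exp L ^ 2 * ((99 / 70) ^ 2 + 99 * π / 35 * (99 / 70) + 99 * π / 35) with hA₁
  set A₂ : ℝ → ℝ := fun L ↦ Real.exp L ^ 2 * (99 / 70 + 2 * (99 * π / 35)) with hA₂
  have hv : ∀ L, Summable (fun n ↦ |c n| * (A₁ L * remainderPoly n) + A₂ L * (|c n| * |ψ n 1|)) :=
    fun L ↦ (summable_abs_coeff_mul_remainderPoly_of_core d (A₁ L)).add
      (summable_abs_coeff_mul_apply_one_of_core d (A₂ L))
  -- termwise iterated derivatives within `[0, L]`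
  have hterm : ∀ L, 0 < L → ∀ k, k ≤ 2 → ∀ n, ∀ x ∈ Icc 0 L,
      iteratedDerivWithin k (fun x ↦ c n * g n x) (Icc 0 L) x = c n * iteratedDeriv k (g n) x := by
    intro L hL k hk n x hx
    rw [iteratedDerivWithin_const_mul_field,
      iteratedDerivWithin_eq_iteratedDeriv (uniqueDiffOn_Icc hL)
        (((hg n).1.of_le (by exact_mod_cast hk)).contDiffAt) hx]
  have hiter : ∀ k, k ≤ 2 → ∀ n x,
      |iteratedDeriv k (g n) x| = |g n x| ∨ |iteratedDeriv k (g n) x| = |deriv (g n) x| ∨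
        |iteratedDeriv k (g n) x| = |deriv (deriv (g n)) x| := by
    intro k hk n x
    interval_cases k
    · exact Or.inl (by rw [iteratedDeriv_zero])
    · exact Or.inr (Or.inl (by rw [iteratedDeriv_one]))
    · exact Or.inr (Or.inr (by rw [show (2 : ℕ) = 1 + 1 from rfl, iteratedDeriv_succ,
        iteratedDeriv_one]))
  have hbd : ∀ L, 0 < L → ∀ k, k ≤ 2 → ∀ n, ∀ x ∈ Icc 0 L,
      ‖iteratedDerivWithin k (fun x ↦ c n * g n x) (Icc 0 L) x‖
        ≤ |c n| * (A₁ L * remainderPoly n) + A₂ L * (|c n| * |ψ n 1|) := by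
    intro L hL k hk n x hx
    rw [hterm L hL k hk n x hx, norm_mul, Real.norm_eq_abs, Real.norm_eq_abs,
      show |c n| * (A₁ L * remainderPoly n) + A₂ L * (|c n| * |ψ n 1|)
        = |c n| * (A₁ L * remainderPoly n + A₂ L * |ψ n 1|) by ring]
    refine mul_le_mul_of_nonneg_left ?_ (abs_nonneg _)
    obtain ⟨b0, b1, b2⟩ := (d n).abs_derivs_le_poly (hg n).2.1 (hg n).2.2.2.2.1
      (hg n).2.2.2.2.2 hx
    rcases hiter k hk n x with h | h | h <;> rw [h]
    · exact b0
    · exact b1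
    · exact b2
  -- the M-test on every `[0, L]`
  have hMt : ∀ L, 0 < L → ContDiffOn ℝ 2 (fun x ↦ ∑' n, c n * g n x) (Icc 0 L) ∧
      ∀ k, k ≤ 2 → ∀ x ∈ Icc 0 L,
        iteratedDerivWithin k (fun x ↦ ∑' n, c n * g n x) (Icc 0 L) x =
          ∑' n, iteratedDerivWithin k (fun x ↦ c n * g n x) (Icc 0 L) x := fun L hL ↦
    contDiffOn_tsum_of_iteratedDerivWithin_le (convex_Icc 0 L) (uniqueDiffOn_Icc hL)
      (N := 2) (U := fun n x ↦ c n * g n x)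
      (v := fun _ n ↦ |c n| * (A₁ L * remainderPoly n) + A₂ L * (|c n| * |ψ n 1|))
      (fun n ↦ (contDiff_const.mul (hg n).1).contDiffOn) (fun k _ ↦ hv L) (hbd L hL)
  refine ⟨g, fun n ↦ (hg n).1, fun n x hx ↦ ?_, fun n ↦ (hg n).2.2.1, fun n ↦ ?_,
    fun n x hx ↦ sonineQTerm_exp_eq (hg n).2.2.2.2.2 hx, fun L hL ↦ ⟨(hMt L hL).1, ?_⟩⟩
  · rw [epsTerm_eq_ofReal_of_isProlateFunction (d n).isProlate hx, (d n).prolateLambda_eq,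
      (hg n).2.1 x hx]
  · rw [(hg n).2.2.2.1, epsSlopeTerm, (d n).prolateLambda_eq,
      (d n).cosTransform_eq 1 ⟨by norm_num, le_rfl⟩]
    ring
  · intro k hk x hx
    refine ⟨?_, ?_⟩
    · refine Summable.of_norm_bounded (hv L) fun n ↦ ?_
      rw [← hterm L hL k hk n x hx]
      exact hbd L hL k hk n x hx
    · rw [(hMt L hL).2 k hk x hx]
      exact tsum_congr fun n ↦ hterm L hL k hk n x hx

/-- **`ε ∘ exp` is `C²` on `[0, ∞)`** (Prop. 5.3 / App. F, additive variable `ρ = e^x`): for THE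
even prolate family with its App. F datum (`IsAppEProlateDatum`: (74) `η̃ = λψ` on `[−1,1]`,
`λ² < 1`, (rapid-decay), [Rokhlin–Xiao] Thm 12, [Wang] — exactly the printed inputs, as
hypotheses), the density `epsDensity ψ = ε ∘ exp` of (sonine0) is twice continuously differentiable
on `[0, ∞)` (one-sided at `0`): on every `[0, L]` the series of the Lemma 5.2 terms and of their
first two derivatives converge normally (termwise majorant `|2λ/(1−λ²)|·A(L)p(n)`, summable), so
the sum is `C²` there with termwise derivatives
(`contDiffOn_tsum_of_iteratedDerivWithin_le`).  CC print the estimates for `ρ ≤ 2`; the same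
inequalities give every bounded range.
[cite: ConnesConsani2021, Prop. 5.3 §5 p. 32 (arXiv item Prop. 30, chunk p0020:L59–L67); App. F Lemma F.1 (arXiv Lemma 49), arXiv PDF pp. 54–55] -/
theorem contDiffOn_epsDensity_Ici_of_core (d : ∀ n, IsAppFDatum n (ψ n) (lam n) (χ n)) :
    ContDiffOn ℝ 2 (epsDensity ψ) (Ici 0) := by
  obtain ⟨g, -, hε, -, -, -, hM⟩ := archDensityCore_package d
  have hS : ContDiffOn ℝ 2 (fun x ↦ ∑' n, 2 * lam n / (1 - lam n ^ 2) * g n x) (Ici 0) :=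
    contDiffOn_Ici_of_Icc fun b hb ↦ (hM b hb).1
  refine (Complex.ofRealCLM.contDiff.comp_contDiffOn hS).congr fun x hx ↦ ?_
  rw [Function.comp_apply, Complex.ofRealCLM_apply, Complex.ofReal_tsum, epsDensity,
    abs_of_nonneg (mem_Ici.1 hx)]
  exact tsum_congr fun n ↦ hε n x (mem_Ici.1 hx)

/-- **Lemma 5.4, additive form, conditional exactly on the App. F datum**: the series
`Σ t(n) = Σ 2λ(n)²ψ_n(1)²/(1−λ(n)²)` (`epsSlopeTerm`; CC's `λ(n)²(1−λ(n)²)⁻¹ξ_n(1)²`) converges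
and is the right derivative of `ε ∘ exp = epsDensity ψ` at `0` (termwise: `∂_x|_{0⁺}` of the Lemma
5.2 term is `ψ(1)η̃(1) = λψ(1)²` by (74) at `x = 1`; term-by-term differentiation by the M-test).
[cite: ConnesConsani2021, Lemma 5.4 §5 pp. 32–33 (arXiv item Lemma 31, chunk p0020:L86–L101)] -/
theorem hasDerivWithinAt_epsDensity_zero_of_core
    (d : ∀ n, IsAppFDatum n (ψ n) (lam n) (χ n)) :
    Summable (fun n ↦ epsSlopeTerm (ψ n)) ∧
      HasDerivWithinAt (epsDensity ψ) ((∑' n, epsSlopeTerm (ψ n) : ℝ) : ℂ) (Ici 0) 0 := by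
  obtain ⟨g, -, hε, -, hslope, -, hM⟩ := archDensityCore_package d
  have h01 : (0 : ℝ) ∈ Icc (0 : ℝ) 1 := ⟨le_rfl, zero_le_one⟩
  obtain ⟨hsum, hder⟩ := (hM 1 one_pos).2 1 (by norm_num) 0 h01
  simp only [iteratedDeriv_one, hslope, iteratedDerivWithin_one] at hsum hder
  refine ⟨hsum, ?_⟩
  have hd : DifferentiableWithinAt ℝ (fun x ↦ ∑' n, 2 * lam n / (1 - lam n ^ 2) * g n x)
      (Icc 0 1) 0 := (hM 1 one_pos).1.differentiableOn (by norm_num) 0 h01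
  have h1 := hd.hasDerivWithinAt
  rw [hder, ← Ici_inter_Iic] at h1
  have h2 := ((hasDerivWithinAt_inter (Iic_mem_nhds zero_lt_one)).1 h1).ofReal_comp
  refine h2.congr (fun x hx ↦ ?_) ?_
  · rw [Complex.ofReal_tsum, epsDensity, abs_of_nonneg (mem_Ici.1 hx)]
    exact tsum_congr fun n ↦ hε n x (mem_Ici.1 hx)
  · rw [Complex.ofReal_tsum, epsDensity, abs_zero]
    exact tsum_congr fun n ↦ hε n 0 le_rfl

/-- **Prop. 5.3 (ii), additive form, conditional exactly on the App. F datum**: for `y > 0`,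
`(Q(ε∘exp))(y) = −(ε∘exp)″(y) + (ε∘exp)(y)/4 = Σ_n τ(n)T_n(e^y)` — the series (qe)/(sonineQ) of the
terms `sonineQTerm (ψ n) (λ(n)) (e^y)` converges to `opQ (epsDensity ψ) y` (termwise second
derivatives by the M-test at the interior point `y`, and `Q` of the Lemma 5.2 term = (98),
`sonineQTerm_exp_eq`).
[cite: ConnesConsani2021, Prop. 5.3 eqs. (97)–(98) §5 p. 32 (arXiv item Prop. 30, chunk p0020:L59–L67)] -/
theorem hasSum_sonineQTerm_opQ_epsDensity_of_core (d : ∀ n, IsAppFDatum n (ψ n) (lam n) (χ n))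
    {y : ℝ} (hy : 0 < y) :
    HasSum (fun n ↦ ((sonineQTerm (ψ n) (lam n) (Real.exp y) : ℝ) : ℂ))
      (opQ (epsDensity ψ) y) := by
  obtain ⟨g, -, hε, -, -, hQ, hM⟩ := archDensityCore_package d
  set S : ℝ → ℝ := fun x ↦ ∑' n, 2 * lam n / (1 - lam n ^ 2) * g n x with hS
  have hL : 0 < y + 1 := by linarith
  obtain ⟨hC, hk⟩ := hM (y + 1) hL
  have hyI : y ∈ Icc 0 (y + 1) := ⟨hy.le, by linarith⟩
  have hyo : Ioo 0 (y + 1) ∈ 𝓝 y := Ioo_mem_nhds hy (by linarith)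
  -- `S` is `C²` near `y`; its first two derivatives there
  have hopen : IsOpen (Ioo 0 (y + 1)) := isOpen_Ioo
  obtain ⟨hdiff, -, hC1⟩ := (contDiffOn_succ_iff_deriv_of_isOpen (n := 1) hopen).1
    (by simpa [one_add_one_eq_two] using hC.mono Ioo_subset_Icc_self)
  have hd1 : ∀ t ∈ Ioo 0 (y + 1), HasDerivAt S (deriv S t) t := fun t ht ↦
    ((hdiff t ht).differentiableAt (hopen.mem_nhds ht)).hasDerivAt
  have hd2 : HasDerivAt (deriv S) (deriv (deriv S) y) y :=
    (((hC1.differentiableOn one_ne_zero) y ⟨hy, by linarith⟩).differentiableAt hyo).hasDerivAt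
  -- second derivative of `S` at `y` = the within-`[0, y+1]` one = the termwise series
  have hSy : ContDiffAt ℝ 2 S y := hC.contDiffAt (Icc_mem_nhds hy (by linarith))
  obtain ⟨hsum2, hder2⟩ := hk 2 le_rfl y hyI
  obtain ⟨hsum0, -⟩ := hk 0 (by norm_num) y hyI
  have e2 : ∀ f : ℝ → ℝ, iteratedDeriv 2 f = deriv (deriv f) := fun f ↦ by
    rw [show (2 : ℕ) = 1 + 1 from rfl, iteratedDeriv_succ, iteratedDeriv_one]
  rw [iteratedDerivWithin_eq_iteratedDeriv (uniqueDiffOn_Icc hL) hSy hyI] at hder2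
  simp only [e2] at hder2 hsum2
  simp only [iteratedDeriv_zero] at hsum0
  -- the complex density near `y`
  have hEq : epsDensity ψ =ᶠ[𝓝 y] fun t ↦ ((S t : ℝ) : ℂ) := by
    filter_upwards [hyo] with t ht
    rw [hS]
    dsimp only
    rw [Complex.ofReal_tsum, epsDensity, abs_of_nonneg ht.1.le]
    exact tsum_congr fun n ↦ hε n t ht.1.le
  have hD1 : deriv (fun t ↦ ((S t : ℝ) : ℂ)) =ᶠ[𝓝 y] fun t ↦ ((deriv S t : ℝ) : ℂ) := by
    filter_upwards [hyo] with t ht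
    exact (hd1 t ht).ofReal_comp.deriv
  have hdd : deriv (deriv (epsDensity ψ)) y = ((deriv (deriv S) y : ℝ) : ℂ) := by
    rw [hEq.deriv.deriv_eq, hD1.deriv_eq]
    exact hd2.ofReal_comp.deriv
  -- assemble
  have h2 : HasSum (fun n ↦ 2 * lam n / (1 - lam n ^ 2) * deriv (deriv (g n)) y)
      (deriv (deriv S) y) := by rw [hder2]; exact hsum2.hasSum
  have h0 : HasSum (fun n ↦ 2 * lam n / (1 - lam n ^ 2) * g n y) (S y) := hsum0.hasSum
  have hfun : (fun n ↦ ((sonineQTerm (ψ n) (lam n) (Real.exp y) : ℝ) : ℂ)) =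
      fun n ↦ ((-(2 * lam n / (1 - lam n ^ 2) * deriv (deriv (g n)) y)
        + 2 * lam n / (1 - lam n ^ 2) * g n y / 4 : ℝ) : ℂ) := by
    funext n
    rw [← hQ n y hy.le]
    push_cast
    ring
  have hval : opQ (epsDensity ψ) y = ((-deriv (deriv S) y + S y / 4 : ℝ) : ℂ) := by
    rw [opQ_apply, hdd, hEq.self_of_nhds]
    push_cast
    ring
  rw [hfun, hval]
  exact Complex.hasSum_ofReal.2 (h2.neg.add (h0.div_const 4))

/-- **The `C²` branch has vanishing one-sided second derivative at `0`** (Remark 5.6 «`Qε(1) = 0`»,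
on the `C²` branch): for any `C²` function `G` agreeing with `ε ∘ exp` on `[0,∞)`,
`G″(0) = Σ_n (2λ/(1−λ²))·g_n″(0) = 0` — termwise `Q` of the Lemma 5.2 term at `x = 0` is
`τ(n)T_n(1) = 0` (`sonineQTerm_one_eq_zero`) and `g_n(0) = 0`.
[cite: ConnesConsani2021, Rem. 5.6 §5 p. 34 (arXiv item Rem. 33, chunk p0021:L10)] -/
theorem deriv_deriv_archDensity_zero_of_core (d : ∀ n, IsAppFDatum n (ψ n) (lam n) (χ n))
    {G : ℝ → ℂ} (hG : ContDiff ℝ 2 G) (hGa : IsArchDensity G) : deriv (deriv G) 0 = 0 := by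
  obtain ⟨g, -, hε, hg0, -, hQ, hM⟩ := archDensityCore_package d
  set S : ℝ → ℝ := fun x ↦ ∑' n, 2 * lam n / (1 - lam n ^ 2) * g n x with hS
  have hψ : ∀ n, IsProlateFunction 1 (2 * n) (ψ n) := fun n ↦ (d n).isProlate
  have h01 : (0 : ℝ) ∈ Icc (0 : ℝ) 1 := ⟨le_rfl, zero_le_one⟩
  obtain ⟨hC, hk⟩ := hM 1 one_pos
  obtain ⟨hsum2, hder2⟩ := hk 2 le_rfl 0 h01
  -- termwise: `c_n g_n″(0) = 0`
  have hzero : ∀ n, 2 * lam n / (1 - lam n ^ 2) * deriv (deriv (g n)) 0 = 0 := by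
    intro n
    obtain ⟨hf, -, -, -, -⟩ := hasDerivWithinAt_package (d n).isProlate
    have hψc : ContinuousOn (ψ n) (Icc (-1) 1) := fun x hx ↦ (hf x hx).continuousWithinAt
    have h1 := hQ n 0 le_rfl
    rw [Real.exp_zero, sonineQTerm_one_eq_zero hψc
      (hf 1 ⟨by norm_num, le_rfl⟩).differentiableWithinAt (d n).cosTransform_eq, hg0 n,
      zero_div, add_zero, mul_neg, neg_eq_zero] at h1
    exact h1
  have e2 : ∀ f : ℝ → ℝ, iteratedDeriv 2 f = deriv (deriv f) := fun f ↦ by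
    rw [show (2 : ℕ) = 1 + 1 from rfl, iteratedDeriv_succ, iteratedDeriv_one]
  have hS2 : iteratedDerivWithin 2 S (Icc 0 1) 0 = 0 := by
    rw [hder2]
    simp only [e2, hzero, tsum_zero]
  -- `G` agrees with `S` on `[0, 1]`
  have hGS : EqOn G (fun t ↦ ((S t : ℝ) : ℂ)) (Icc 0 1) := by
    intro t ht
    rw [hGa ψ hψ t ht.1, hS]
    dsimp only
    rw [Complex.ofReal_tsum, epsDensity, abs_of_nonneg ht.1]
    exact tsum_congr fun n ↦ hε n t ht.1
  have hset : (Icc 0 1 : Set ℝ) =ᶠ[𝓝 (0 : ℝ)] Ici 0 := by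
    filter_upwards [Iic_mem_nhds (zero_lt_one' ℝ)] with t ht
    simp only [eq_iff_iff]
    exact ⟨fun h ↦ h.1, fun h ↦ ⟨h, ht⟩⟩
  calc deriv (deriv G) 0 = iteratedDeriv 2 G 0 := by
        rw [show (2 : ℕ) = 1 + 1 from rfl, iteratedDeriv_succ, iteratedDeriv_one]
    _ = iteratedDerivWithin 2 G (Ici 0) 0 :=
        (iteratedDerivWithin_eq_iteratedDeriv (uniqueDiffOn_Ici 0) hG.contDiffAt self_mem_Ici).symm
    _ = iteratedDerivWithin 2 G (Icc 0 1) 0 := by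
        rw [iteratedDerivWithin, iteratedDerivWithin, iteratedFDerivWithin_congr_set hset.symm]
    _ = iteratedDerivWithin 2 (fun t ↦ ((S t : ℝ) : ℂ)) (Icc 0 1) 0 :=
        iteratedDerivWithin_congr hGS h01
    _ = ((iteratedDerivWithin 2 S (Icc 0 1) 0 : ℝ) : ℂ) :=
        iteratedDerivWithin_ofReal_comp hC (uniqueDiffOn_Icc one_pos) h01 le_rfl
    _ = 0 := by rw [hS2, Complex.ofReal_zero]

/-- **Remark 5.6 (`Qε(1) = 0` on the `C²` branch), conditional exactly on the App. F datum of THE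
prolate family**: `opQ G 0 = −G″(0) + G(0)/4 = 0` for every `C²` archimedean density `G`
(`G(0) = ε(1) = 0`, `IsArchDensity.apply_zero`; `G″(0) = 0`,
`deriv_deriv_archDensity_zero_of_core`) —
the §5 file's named fact `CC2021_rem_5_6`.
[cite: ConnesConsani2021, Rem. 5.6 §5 p. 34 (arXiv item Rem. 33, chunk p0021:L10)] -/
theorem CC2021_rem_5_6_of_core (d : ∀ n, IsAppFDatum n (ψ n) (lam n) (χ n)) :
    CC2021_rem_5_6 := by
  intro G hG hGa
  rw [opQ_apply, deriv_deriv_archDensity_zero_of_core d hG hGa, hGa.apply_zero]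
  simp

/-- **There is a `C²` function on `ℝ` that agrees with `ε ∘ exp` on `[0, ∞)`** — route item K0
`DensityRegular` / the hypothesis `hG : ContDiff ℝ 2 G` of (H-ε), conditional exactly on the App. F
prolate datum: a `C²` function on `[0,∞)` extends to `ℝ` (`exists_contDiff_extension_Ici`, Whitney
1934 in dimension one), and `IsArchDensity` only reads `[0,∞)` (one prolate family:
`prolateFamily_unique`); its slope at `0` is `Σ' t(n)` and its second derivative at `0` vanishes.
[cite: ConnesConsani2021, Prop. 5.3 §5 p. 32 (arXiv item Prop. 30); §5 eq. (Eprime) p. 33 (chunk p0020:L107–110); App. F Lemma F.1 (arXiv Lemma 49), arXiv PDF pp. 54–55] -/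
theorem exists_contDiff_isArchDensity_of_core (d : ∀ n, IsAppFDatum n (ψ n) (lam n) (χ n)) :
    ∃ G : ℝ → ℂ, ContDiff ℝ 2 G ∧ IsArchDensity G ∧ EqOn G (epsDensity ψ) (Ici 0) ∧
      deriv G 0 = ((∑' n, epsSlopeTerm (ψ n) : ℝ) : ℂ) ∧ deriv (deriv G) 0 = 0 := by
  obtain ⟨G, hG, hGε, -⟩ :=
    exists_contDiff_extension_Ici (N := 2) (contDiffOn_epsDensity_Ici_of_core d)
  have hψ : ∀ n, IsProlateFunction 1 (2 * n) (ψ n) := fun n ↦ (d n).isProlate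
  have hGa : IsArchDensity G := fun ψ' hψ' x hx ↦ by
    rw [hGε (mem_Ici.2 hx), prolateFamily_unique hψ hψ']
  refine ⟨G, hG, hGa, hGε, ?_, deriv_deriv_archDensity_zero_of_core d hG hGa⟩
  have hU : UniqueDiffWithinAt ℝ (Ici (0 : ℝ)) 0 := uniqueDiffOn_Ici 0 0 self_mem_Ici
  have hGd : DifferentiableAt ℝ G 0 := (hG.differentiable (by norm_num)) 0
  have hGS : HasDerivWithinAt G ((∑' n, epsSlopeTerm (ψ n) : ℝ) : ℂ) (Ici 0) 0 :=
    (hasDerivWithinAt_epsDensity_zero_of_core d).2.congr (fun x hx ↦ hGε hx) (hGε self_mem_Ici)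
  rw [← hGd.derivWithin hU, hGS.derivWithin hU]

/-- **Lemma 5.4 as typed by the §5 file (`CC2021_lemma_5_4`, multiplicative form at `ρ = 1⁺`),
conditional exactly on the App. F datum of THE prolate family** (any prolate family is that one:
`prolateFamily_unique`).
[cite: ConnesConsani2021, Lemma 5.4 §5 pp. 32–33 (arXiv item Lemma 31, chunk p0020:L86–L101)] -/
theorem CC2021_lemma_5_4_of_core (d : ∀ n, IsAppFDatum n (ψ n) (lam n) (χ n)) :
    CC2021_lemma_5_4 := by
  intro ψ' hψ'
  have hψ : ∀ n, IsProlateFunction 1 (2 * n) (ψ n) := fun n ↦ (d n).isProlate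
  obtain rfl : ψ = ψ' := prolateFamily_unique hψ hψ'
  obtain ⟨hsum, hHas⟩ := hasDerivWithinAt_epsDensity_zero_of_core d
  exact ⟨hsum, (hasDerivWithinAt_ccEpsilon_iff ψ _).2 hHas⟩

/-- **Prop. 5.3 as typed by the §5 file (`CC2021_prop_5_3`), conditional exactly on the App. F
datum of THE prolate family**: `ε = ccEpsilon ψ` is `C²` on `(1, ∞)` and, for every `ρ > 1`,
`(Qε)(ρ) = Σ_n τ(n)T_n(ρ)` as a convergent series (`opQ_comp_exp` turns `Q` in `ρ` into
`−∂_y² + ¼` in `y = log ρ`; `λ(n) = prolateLambda (ψ n)` by `prolateLambda_eq`).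
[cite: ConnesConsani2021, Prop. 5.3 eqs. (97)–(98) §5 p. 32 (arXiv item Prop. 30, chunk p0020:L59–L67)] -/
theorem CC2021_prop_5_3_of_core (d : ∀ n, IsAppFDatum n (ψ n) (lam n) (χ n)) :
    CC2021_prop_5_3 := by
  intro ψ' hψ'
  have hψ : ∀ n, IsProlateFunction 1 (2 * n) (ψ n) := fun n ↦ (d n).isProlate
  obtain rfl : ψ = ψ' := prolateFamily_unique hψ hψ'
  -- (i) regularity on `(1, ∞)`: `ε = (ε ∘ exp) ∘ log`
  have hreg : ContDiffOn ℝ 2 (ccEpsilon ψ) (Ioi 1) := by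
    have hlog : ContDiffOn ℝ 2 Real.log (Ioi 1) :=
      (Real.contDiffOn_log.of_le le_top).mono fun r hr ↦ ne_of_gt (lt_trans zero_lt_one hr)
    refine ((contDiffOn_epsDensity_Ici_of_core d).comp hlog fun r hr ↦ ?_).congr fun r _ ↦ rfl
    exact mem_Ici.2 (Real.log_nonneg (le_of_lt hr))
  refine ⟨hreg, fun ρ hρ ↦ ?_⟩
  -- (ii) the series at `ρ = e^y`, `y = log ρ > 0`
  have hρ0 : 0 < ρ := lt_trans zero_lt_one hρ
  have hy : 0 < Real.log ρ := Real.log_pos hρ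
  have h := hasSum_sonineQTerm_opQ_epsDensity_of_core d hy
  rw [Real.exp_log hρ0] at h
  have hfun : (fun n ↦ ((sonineQTerm (ψ n) (prolateLambda (ψ n)) ρ : ℝ) : ℂ)) =
      fun n ↦ ((sonineQTerm (ψ n) (lam n) ρ : ℝ) : ℂ) := by
    funext n; rw [(d n).prolateLambda_eq]
  rw [hfun]
  -- `opQ (ε ∘ exp) (log ρ) = (Qε)(ρ)`
  have hopen : IsOpen (Ioi (1 : ℝ)) := isOpen_Ioi
  have hex : Real.exp (Real.log ρ) ∈ Ioi (1 : ℝ) := by rw [Real.exp_log hρ0]; exact hρ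
  obtain ⟨hdiff, -, hC1⟩ := (contDiffOn_succ_iff_deriv_of_isOpen (n := 1) hopen).1
    (by simpa [one_add_one_eq_two] using hreg)
  have h1 : ∀ᶠ r in 𝓝 (Real.exp (Real.log ρ)), DifferentiableAt ℝ (ccEpsilon ψ) r := by
    filter_upwards [hopen.mem_nhds hex] with r hr
    exact (hdiff r hr).differentiableAt (hopen.mem_nhds hr)
  have h2 : DifferentiableAt ℝ (fun r : ℝ ↦ r • deriv (ccEpsilon ψ) r) (Real.exp (Real.log ρ)) := by
    have hd : DifferentiableAt ℝ (deriv (ccEpsilon ψ)) (Real.exp (Real.log ρ)) :=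
      ((hC1.differentiableOn one_ne_zero) _ hex).differentiableAt (hopen.mem_nhds hex)
    exact differentiableAt_id.smul hd
  have hcomp : (fun t ↦ ccEpsilon ψ (Real.exp t)) = epsDensity ψ := by
    funext t; rw [ccEpsilon, Real.log_exp]
  have hQ : opQ (epsDensity ψ) (Real.log ρ) = mulOpQ (ccEpsilon ψ) ρ := by
    rw [← hcomp, opQ_comp_exp h1 h2, Real.exp_log hρ0]
  rwa [hQ] at h

end Assembly


/-! ## THE prolate family: the core datum from the §4 facts; K0, Lemma 5.4, Prop. 5.3, Rem. 5.6
modulo exactly `CC2021_sec4_lambda_basic` and `CC2021_sec4_rapidDecay` -/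

section ProlateFun

/-- **K0 `DensityRegular` modulo exactly the §4 named facts (cosalphan) [PROVED], `|λ|<1`,
(rapid-decay)** — no endpoint input: there is a `C²` function on `ℝ` agreeing with `ε ∘ exp` on
`[0,∞)` (an archimedean density), with slope `Σ' t(n)` and vanishing second derivative at `0`.
[cite: ConnesConsani2021, Prop. 5.3 §5 p. 32 (arXiv item Prop. 30); Lemma 5.4 pp. 32–33; App. F Lemma F.1 (arXiv Lemma 49), arXiv PDF pp. 54–55] -/
theorem exists_contDiff_isArchDensity_prolateFun (hcos : CC2021_sec4_cosalphan)
    (hbasic : CC2021_sec4_lambda_basic) (hrapid : CC2021_sec4_rapidDecay) :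
    ∃ G : ℝ → ℂ, ContDiff ℝ 2 G ∧ IsArchDensity G ∧ EqOn G (epsDensity prolateFun) (Ici 0) ∧
      deriv G 0 = ((∑' n, epsSlopeTerm (prolateFun n) : ℝ) : ℂ) ∧ deriv (deriv G) 0 = 0 := by
  choose χ hχ using exists_isAppFDatum_prolateFun hcos hbasic hrapid
  exact exists_contDiff_isArchDensity_of_core hχ

/-- **Lemma 5.4 (`CC2021_lemma_5_4`) modulo exactly (cosalphan) [PROVED], `|λ|<1`, (rapid-decay)**
— no endpoint input.
[cite: ConnesConsani2021, Lemma 5.4 §5 pp. 32–33 (arXiv item Lemma 31, chunk p0020:L86–L101)] -/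
theorem CC2021_lemma_5_4_of_sec4 (hcos : CC2021_sec4_cosalphan)
    (hbasic : CC2021_sec4_lambda_basic) (hrapid : CC2021_sec4_rapidDecay) : CC2021_lemma_5_4 := by
  choose χ hχ using exists_isAppFDatum_prolateFun hcos hbasic hrapid
  exact CC2021_lemma_5_4_of_core hχ

/-- **Prop. 5.3 (`CC2021_prop_5_3`) modulo exactly (cosalphan) [PROVED], `|λ|<1`, (rapid-decay)**.
[cite: ConnesConsani2021, Prop. 5.3 eqs. (97)–(98) §5 p. 32 (arXiv item Prop. 30, chunk p0020:L59–L67)] -/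
theorem CC2021_prop_5_3_of_sec4 (hcos : CC2021_sec4_cosalphan)
    (hbasic : CC2021_sec4_lambda_basic) (hrapid : CC2021_sec4_rapidDecay) : CC2021_prop_5_3 := by
  choose χ hχ using exists_isAppFDatum_prolateFun hcos hbasic hrapid
  exact CC2021_prop_5_3_of_core hχ

/-- **Rem. 5.6 (`CC2021_rem_5_6`) modulo exactly (cosalphan) [PROVED], `|λ|<1`, (rapid-decay)**.
[cite: ConnesConsani2021, Rem. 5.6 §5 p. 34 (arXiv item Rem. 33, chunk p0021:L10)] -/
theorem CC2021_rem_5_6_of_sec4 (hcos : CC2021_sec4_cosalphan)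
    (hbasic : CC2021_sec4_lambda_basic) (hrapid : CC2021_sec4_rapidDecay) : CC2021_rem_5_6 := by
  choose χ hχ using exists_isAppFDatum_prolateFun hcos hbasic hrapid
  exact CC2021_rem_5_6_of_core hχ

end ProlateFun

end Literature.NumberTheory.ConnesConsani2021

end
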